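import Summits.Langlands.Langlands.Theorems.RationalPeriodQuarterAnalyticCoreInfinity
import Summits.Langlands.Langlands.Theorems.RationalPeriodQuarterAnalyticCoreZero

/-!
# `AnalyticCore` — child 2 of the lens-1-g38 split of `RationalPeriodQuarter.SemiAnalyticRigidity`

`analyticCore_statement` proves, over Mathlib only, the statement of the child `AnalyticCore` VERBATIM
(source of truth: the node's `statements.json`): a function `f`, real-analytic off a finite set, tame
(analytic + rational) relative to a piecewise-rational `ρ` at every point, whose `T`- and `γ₀(N)`-slash
differences are cofinitely piecewise-rational, is cofinitely equal to a piecewise-rational function.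

Assembly: `Δ(f-ρ)` is tame and one fraction `A/B` (OneFrac); the `γ₀`-relation gives the two charts of
`f-ρ` at infinity (Mobius); the chart identity and rigidity through `u = 0` produce the rational correction
`E` with `Δ(f-ρ-E) = 0` cofinitely and `f-ρ-E = ±(u·G u + w u)` on the charts (Charts, Infinity); the periodic
step (Zero) gives `f = ρ + E` cofinitely, and `ρ + E` is piecewise rational.
-/

set_option linter.dupNamespace false

namespace Summit.Langlands.Langlands.Theorems

open Filter Set Topology Polynomial

/-- CHILD 2 (`AnalyticCore`) of the lens-1-g38 split of `RationalPeriodQuarter.SemiAnalyticRigidity`, verbatim. -/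
theorem analyticCore_statement :
    let IsPRC : (ℝ → ℂ) → Prop := fun φ => ∃ F : Finset ℚ, (∀ a b : ℚ, a < b → (∀ r ∈ F, r ≤ a ∨ b ≤ r) → ∃ (P : Polynomial ℂ) (Q : Polynomial ℚ), ∀ x : ℝ, (a : ℝ) < x → x < b → Polynomial.aeval (x : ℂ) Q ≠ 0 ∧ φ x = Polynomial.eval (x : ℂ) P / Polynomial.aeval (x : ℂ) Q) ∧ ∃ B : ℚ, (∃ (P : Polynomial ℂ) (Q : Polynomial ℚ), ∀ x : ℝ, (B : ℝ) < x → Polynomial.aeval (x : ℂ) Q ≠ 0 ∧ φ x = Polynomial.eval (x : ℂ) P / Polynomial.aeval (x : ℂ) Q) ∧ (∃ (P : Polynomial ℂ) (Q : Polynomial ℚ), ∀ x : ℝ, x < -(B : ℝ) → Polynomial.aeval (x : ℂ) Q ≠ 0 ∧ φ x = Polynomial.eval (x : ℂ) P / Polynomial.aeval (x : ℂ) Q); let IsPW : (ℝ → ℂ) → Prop := fun ρ => ∃ E : Finset ℝ, (∀ x : ℝ, x ∉ E → ∃ (P Q : Polynomial ℂ), ∀ᶠ (t : ℝ) in nhds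 x, Polynomial.eval (t : ℂ) Q ≠ 0 ∧ ρ t = Polynomial.eval (t : ℂ) P / Polynomial.eval (t : ℂ) Q) ∧ ∃ B : ℝ, (∃ (P Q : Polynomial ℂ), ∀ t : ℝ, B < t → Polynomial.eval (t : ℂ) Q ≠ 0 ∧ ρ t = Polynomial.eval (t : ℂ) P / Polynomial.eval (t : ℂ) Q) ∧ (∃ (P Q : Polynomial ℂ), ∀ t : ℝ, t < -B → Polynomial.eval (t : ℂ) Q ≠ 0 ∧ ρ t = Polynomial.eval (t : ℂ) P / Polynomial.eval (t : ℂ) Q); let TameAt : (ℝ → ℂ) → ℝ → Prop := fun h x => ∃ g : ℝ → ℂ, AnalyticAt ℝ g x ∧ ∃ (P Q : Polynomial ℂ), Q ≠ 0 ∧ ∀ᶠ (t : ℝ) in nhdsWithin x {x}ᶜ, h t = g t + Polynomial.eval (t : ℂ) P / Polynomial.eval (t : ℂ) Q; ∀ N : ℕ, 0 < N → ∀ f ρ : ℝ → ℂ, (∃ F : Finset ℝ, AnalyticOnNhd ℝ f ((↑F : Set ℝ)ᶜ)) → IsPW ρ → (∀ x : ℝ, TameAt (fun t => f t - ρ t)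 x) → (∃ q : ℝ → ℂ, IsPRC q ∧ ∀ᶠ t in Filter.cofinite, f (t + 1) - f t = q t) → (∃ q : ℝ → ℂ, IsPRC q ∧ ∀ᶠ t in Filter.cofinite, (((|(N : ℝ) * t + 1|⁻¹ : ℝ) : ℂ)) * f (t / ((N : ℝ) * t + 1)) - f t = q t) → ∃ ρ' : ℝ → ℂ, IsPW ρ' ∧ ∀ᶠ t in Filter.cofinite, f t = ρ' t := by
  classical
  intro IsPRC IsPW TameAt N hN f ρ hsa hρ htame hT hγ
  dsimp only [IsPRC, IsPW, TameAt] at hρ htame hT hγ ⊢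
  have hN' : (0 : ℝ) < N := by exact_mod_cast hN
  -- `ρ` data
  obtain ⟨Eρ, hρloc, Bρ, ⟨Pr, Qr, hρR⟩, ⟨Pl, Ql, hρL⟩⟩ := hρ
  -- `Δ(f - ρ)` is one fraction `A/B`
  obtain ⟨q₁, ⟨F₁, -, Bq₁, ⟨P₁, D₁, hq₁R⟩, ⟨P₁l, D₁l, hq₁L⟩⟩, hT₁⟩ := hT
  obtain ⟨A₀, B₀, hB₀, R₀, hB₀R, hk₀⟩ :=
    anCore_delta_tail_right f ρ q₁ hT₁ (Bq₁ : ℝ) P₁ D₁ hq₁R Bρ Pr Qr hρR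
  obtain ⟨A₁, B₁, hB₁, R₁, hB₁R, hk₁⟩ :=
    anCore_delta_tail_left f ρ q₁ hT₁ (Bq₁ : ℝ) P₁l D₁l hq₁L Bρ Pl Ql hρL
  obtain ⟨A, B, hB, hcoAB, hlocAB, hΔ⟩ :=
    anCore_onefrac (fun t => (f (t + 1) - ρ (t + 1)) - (f t - ρ t))
      (fun x => anCore_tame_delta (fun t => f t - ρ t) htame x) A₀ B₀ hB₀ R₀ hB₀R hk₀ A₁ B₁ R₁ hB₁R hk₁
  -- tame data at `1/N` in metric form
  obtain ⟨g₀, hg₀, P₀, Q₀, hQ₀, hev₀⟩ := htame ((1 : ℝ) / N)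
  have hQ₀ev := tameDecomp_eventually_nhdsNE_of_cofinite
    (tameDecomp_eventually_cofinite_eval_ne_zero hQ₀) ((1 : ℝ) / N)
  obtain ⟨ε₀, hε₀, hball₀⟩ := Metric.eventually_nhds_iff.1 (eventually_nhdsWithin_iff.1 (hQ₀ev.and hev₀))
  -- one-sided pieces of `ρ` at `1/N`
  obtain ⟨Am, Bm, hρm⟩ := anCore_pw_onesided_left ρ Eρ hρloc ((1 : ℝ) / N)
  obtain ⟨Ap, Bp, hρp⟩ := anCore_pw_onesided_right ρ Eρ hρloc ((1 : ℝ) / N)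
  obtain ⟨lm, hlm, hsubm⟩ := mem_nhdsLT_iff_exists_Ioo_subset.1 hρm
  obtain ⟨up, hup, hsubp⟩ := mem_nhdsGT_iff_exists_Ioo_subset.1 hρp
  have hlm' : lm < (1 : ℝ) / N := hlm
  have hup' : (1 : ℝ) / N < up := hup
  set ε : ℝ := min ε₀ (min ((1 : ℝ) / N - lm) (up - (1 : ℝ) / N)) with hεdef
  have hε : 0 < ε := lt_min hε₀ (lt_min (by linarith) (by linarith))
  have hε₁ : ε ≤ ε₀ := min_le_left _ _
  have hε₂ : ε ≤ (1 : ℝ) / N - lm := le_trans (min_le_right _ _) (min_le_left _ _)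
  have hε₃ : ε ≤ up - (1 : ℝ) / N := le_trans (min_le_right _ _) (min_le_right _ _)
  have htm : ∀ t : ℝ, t ≠ (1 : ℝ) / N → |t - 1 / N| < ε →
      Q₀.eval (t : ℂ) ≠ 0 ∧ f t - ρ t = g₀ t + P₀.eval (t : ℂ) / Q₀.eval (t : ℂ) :=
    fun t ht hlt => hball₀ (by rw [Real.dist_eq]; exact lt_of_lt_of_le hlt hε₁) ht
  have hρm' : ∀ t : ℝ, t < (1 : ℝ) / N → (1 : ℝ) / N - ε < t →
      Bm.eval (t : ℂ) ≠ 0 ∧ ρ t = Am.eval (t : ℂ) / Bm.eval (t : ℂ) :=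
    fun t h1 h2 => hsubm ⟨by linarith, h1⟩
  have hρp' : ∀ t : ℝ, (1 : ℝ) / N < t → t < (1 : ℝ) / N + ε →
      Bp.eval (t : ℂ) ≠ 0 ∧ ρ t = Ap.eval (t : ℂ) / Bp.eval (t : ℂ) :=
    fun t h1 h2 => hsubp ⟨h1, by linarith⟩
  -- `γ₀` data
  obtain ⟨q₀, ⟨F₀, -, Bq₀, ⟨Pq, Dq, hq₀R⟩, ⟨Pql, Dql, hq₀L⟩⟩, hγ₀⟩ := hγ
  have hq₀R' : ∀ t : ℝ, (Bq₀ : ℝ) < t → (Dq.map (algebraMap ℚ ℂ)).eval (t : ℂ) ≠ 0 ∧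
      q₀ t = Pq.eval (t : ℂ) / (Dq.map (algebraMap ℚ ℂ)).eval (t : ℂ) := by
    intro t ht
    obtain ⟨h1, h2⟩ := hq₀R t ht
    rw [ratDescent_aeval_eq_eval_map] at h1 h2
    exact ⟨h1, h2⟩
  have hq₀L' : ∀ t : ℝ, t < -(Bq₀ : ℝ) → (Dql.map (algebraMap ℚ ℂ)).eval (t : ℂ) ≠ 0 ∧
      q₀ t = Pql.eval (t : ℂ) / (Dql.map (algebraMap ℚ ℂ)).eval (t : ℂ) := by
    intro t ht
    obtain ⟨h1, h2⟩ := hq₀L t ht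
    rw [ratDescent_aeval_eq_eval_map] at h1 h2
    exact ⟨h1, h2⟩
  obtain ⟨T, -, hγT⟩ := anCore_cofinite_tails hγ₀
  -- the two charts of `f - ρ` at infinity
  obtain ⟨δ₁, hδ₁, Pp, Qp, hright⟩ := anCore_gamma0_tail_right N hN f ρ q₀ g₀ P₀ Q₀ ε hε htm Am Bm hρm'
    Bρ Pr Qr hρR (Bq₀ : ℝ) Pq (Dq.map (algebraMap ℚ ℂ)) hq₀R' T (fun t ht => hγT t (Or.inl ht))
  obtain ⟨δ₂, hδ₂, Pm, Qm, hleft⟩ := anCore_gamma0_tail_left N hN f ρ q₀ g₀ P₀ Q₀ ε hε htm Ap Bp hρp'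
    Bρ Pl Ql hρL (Bq₀ : ℝ) Pql (Dql.map (algebraMap ℚ ℂ)) hq₀L' T (fun t ht => hγT t (Or.inr ht))
  -- the step at infinity
  obtain ⟨PE, QE, hQE0, hΔE, Pw, Qw, hco, δ, hδ, hRt, hLt⟩ := anCore_infinity N hN (fun t => f t - ρ t) g₀ hg₀
    δ₁ hδ₁ Pp Qp hright δ₂ hδ₂ Pm Qm hleft A B hΔ
  -- the periodic step
  have hG : AnalyticAt ℝ (fun u : ℝ => g₀ ((1 - u) / N)) 0 := by
    have hin : AnalyticAt ℝ (fun v : ℝ => (1 - v) / (N : ℝ)) 0 := (analyticAt_const.sub analyticAt_id).div_const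
    have := AnalyticAt.comp_of_eq (g := g₀) (f := fun v : ℝ => (1 - v) / (N : ℝ)) hg₀ hin (by simp)
    simpa [Function.comp_def] using this
  have hk2t : ∀ x : ℝ, ∃ g : ℝ → ℂ, AnalyticAt ℝ g x ∧ ∃ P Q : ℂ[X], Q ≠ 0 ∧
      ∀ᶠ (t : ℝ) in 𝓝[≠] x, (fun t => (f t - ρ t) - PE.eval (t : ℂ) / QE.eval (t : ℂ)) t =
        g t + P.eval (t : ℂ) / Q.eval (t : ℂ) := by
    intro x
    obtain ⟨g, hg, P, Q, hQ, hev⟩ := htame x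
    have hQEev := tameDecomp_eventually_nhdsNE_of_cofinite
      (tameDecomp_eventually_cofinite_eval_ne_zero hQE0) x
    have hQev := tameDecomp_eventually_nhdsNE_of_cofinite
      (tameDecomp_eventually_cofinite_eval_ne_zero hQ) x
    refine ⟨g, hg, P * QE - PE * Q, Q * QE, mul_ne_zero hQ hQE0, ?_⟩
    filter_upwards [hev, hQEev, hQev] with t ht hQEt hQt
    simp only [ht, Polynomial.eval_mul, Polynomial.eval_sub]
    field_simp
    ring
  have hzero := anCore_zero N hN (fun t => (f t - ρ t) - PE.eval (t : ℂ) / QE.eval (t : ℂ))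
    (fun u : ℝ => g₀ ((1 - u) / N)) hG Pw Qw hco δ hδ
    (fun u hu0 hu => ⟨(hRt u hu0 hu).1, (hRt u hu0 hu).2.2⟩)
    (fun u hu0 hu => ⟨(hLt u hu0 hu).1, (hLt u hu0 hu).2.2⟩) hΔE hk2t
  -- `ρ' := ρ + E` is piecewise rational and `f = ρ'` cofinitely
  have hQEcof := tameDecomp_eventually_cofinite_eval_ne_zero hQE0
  have hQEfin : Set.Finite {t : ℝ | ¬ (QE.eval (t : ℂ) ≠ 0)} := Filter.eventually_cofinite.1 hQEcof
  obtain ⟨RE, -, hRE⟩ := anCore_cofinite_tails hQEcof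
  refine ⟨fun t => ρ t + PE.eval (t : ℂ) / QE.eval (t : ℂ), ⟨Eρ ∪ hQEfin.toFinset, ?_, max Bρ RE, ?_, ?_⟩, ?_⟩
  · intro x hx
    rw [Finset.mem_union, not_or] at hx
    obtain ⟨hxE, hxQ⟩ := hx
    have hQEx : QE.eval (x : ℂ) ≠ 0 := by
      by_contra h0
      exact hxQ (hQEfin.mem_toFinset.2 fun h' => h' h0)
    obtain ⟨P, Q, hPQ⟩ := hρloc x hxE
    have hQEnear : ∀ᶠ (t : ℝ) in 𝓝 x, QE.eval (t : ℂ) ≠ 0 :=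
      (anCore_analyticAt_evalC QE x).continuousAt.eventually_ne hQEx
    refine ⟨P * QE + PE * Q, Q * QE, ?_⟩
    filter_upwards [hPQ, hQEnear] with t ht hQEt
    obtain ⟨hQt, hρt⟩ := ht
    refine ⟨by simp only [Polynomial.eval_mul]; exact mul_ne_zero hQt hQEt, ?_⟩
    rw [hρt]
    simp only [Polynomial.eval_mul, Polynomial.eval_add]
    field_simp
  · refine ⟨Pr * QE + PE * Qr, Qr * QE, fun t ht => ?_⟩
    have h1 : Bρ < t := lt_of_le_of_lt (le_max_left _ _) ht
    have h2 : QE.eval (t : ℂ) ≠ 0 := hRE t (Or.inl (lt_of_le_of_lt (le_max_right _ _) ht))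
    obtain ⟨hQr, hρt⟩ := hρR t h1
    refine ⟨by simp only [Polynomial.eval_mul]; exact mul_ne_zero hQr h2, ?_⟩
    show ρ t + PE.eval (t : ℂ) / QE.eval (t : ℂ) = _
    rw [hρt]
    simp only [Polynomial.eval_mul, Polynomial.eval_add]
    field_simp
  · refine ⟨Pl * QE + PE * Ql, Ql * QE, fun t ht => ?_⟩
    have h1 : t < -Bρ := by have := le_max_left Bρ RE; linarith
    have h2 : QE.eval (t : ℂ) ≠ 0 := hRE t (Or.inr (by have := le_max_right Bρ RE; linarith))
    obtain ⟨hQl, hρt⟩ := hρL t h1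
    refine ⟨by simp only [Polynomial.eval_mul]; exact mul_ne_zero hQl h2, ?_⟩
    show ρ t + PE.eval (t : ℂ) / QE.eval (t : ℂ) = _
    rw [hρt]
    simp only [Polynomial.eval_mul, Polynomial.eval_add]
    field_simp
  · filter_upwards [hzero] with t ht
    show f t = ρ t + PE.eval (t : ℂ) / QE.eval (t : ℂ)
    have ht' : (f t - ρ t) - PE.eval (t : ℂ) / QE.eval (t : ℂ) = 0 := ht
    linear_combination ht'

end Summit.Langlands.Langlands.Theorems
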